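import Mathlib
import HarnessLib
import HarnessLib.Audit
import Summits.AtomisticToContinuum.Statement
import Literature.MathematicalPhysics.QuantumManyBody.PeriodicBoseGas

/-!
Route: BECPinning

CLOSED (retired) 2026-08-15T13:39:49Z by operator:999:1257524 — reason: not-a-thesis: assembly does not conclude the sub-problem Statement — note: D-0027 §2.1 audit (human 2026-08-15: routes that do not decide the summit are removed): the assembly concludes `Literature.MathematicalPhysics.QuantumManyBody.BoseGas.BoseEinsteinCondensation`, not the sub-problem statement; a NEW conforming route may be opened from the same idea (generated `closes . The file is kept as the record of this route; refuted decls are indexed as negative knowledge (`ledger negatives`).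

X_H (PINNED LOWER BOUND; formal). It suffices to show PinnedLowerBound: for every repulsive
finite-range radial v there are
C, κ > 0, ρ₀ > 0 such that for 0 < ρ < ρ₀ and all large N (L = (N/ρ)^{1/3}, a = scattering length of
v) there is ONE
normalised one-body mode u = u_{N} on the Dirichlet box with, for EVERY admissible trial state Ψ
(not only near-minimisers),
    ⟨Ψ, H_N Ψ⟩ + (κ/L²)·⟨u, γ_Ψ u⟩  ≥  E₀(N, L) + (κ/L²)·N·(1 − C·√(ρ a³)),
i.e. the ground-state energy of the PINNED Hamiltonian H_N + (κ/L²) Σ_i |u⟩⟨u|_i exceeds E₀ by the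
full pinning reward
κN/L² up to the Bogoliubov depletion fraction C√(ρa³). Equivalently (Hellmann–Feynman / concavity in
κ): the condensate
of the ground state of H_N − (κ'/L²) n₊(u) keeps fraction ≥ 1 − C√(ρa³) for all anti-pinning
strengths κ' ≤ κ.
Consequence: every δ-near-minimiser has ⟨u, γ_Ψ u⟩ ≥ N(1 − C√(ρa³)) − δL²/κ, so with δ = κN/(4L²)
and ρ < (16C²a³)⁻¹
the conjunct's λ_max(γ) ≥ N/4 follows (Assembly, given finiteness of E₀ at low density).
Lean (rc 0 in Sketch.lean; constants: Literature.BoseGas.{IsRepulsiveFiniteRange, TrialState,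
energy, groundStateEnergy,
occupation, sideLength, scatteringLength, BoseEinsteinCondensation},
MeasureTheory.AEStronglyMeasurable, ENNReal.ofReal):
PinnedLowerBound := ∀ v : ℝ → ENNReal,
Literature.MathematicalPhysics.QuantumManyBody.BoseGas.IsRepulsiveFiniteRange v → ∃ C κ ρ₀ : ℝ, 0 <
κ ∧ 0 < ρ₀ ∧ ∀ ρ : ℝ, 0 < ρ → ρ < ρ₀ → ∀ᶠ N : ℕ in Filter.atTop, ∃ u : EuclideanSpace ℝ (Fin 3) → ℂ,
MeasureTheory.AEStronglyMeasurable u MeasureTheory.volume ∧ (∫⁻ x, (‖u x‖₊ : ENNReal) ^ 2) = 1 ∧ ∀ Ψ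
: Literature.MathematicalPhysics.QuantumManyBody.BoseGas.TrialState N
(Literature.MathematicalPhysics.QuantumManyBody.BoseGas.sideLength ρ N),
Literature.MathematicalPhysics.QuantumManyBody.BoseGas.groundStateEnergy v N
(Literature.MathematicalPhysics.QuantumManyBody.BoseGas.sideLength ρ N) + ENNReal.ofReal (κ /
Literature.MathematicalPhysics.QuantumManyBody.BoseGas.sideLength ρ N ^ 2 * N * (1 - C * Real.sqrt
(ρ * (Literature.MathematicalPhysics.QuantumManyBody.BoseGas.scatteringLength v).toReal ^ 3))) ≤
Literature.MathematicalPhysics.QuantumManyBody.BoseGas.energy v Ψ + ENNReal.ofReal (κ /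
Literature.MathematicalPhysics.QuantumManyBody.BoseGas.sideLength ρ N ^ 2) *
Literature.MathematicalPhysics.QuantumManyBody.BoseGas.occupation N u Ψ.ψ

Rationale: WHY THIS LINE. All rigorous progress on the dilute gas is in the currency of ENERGY LOWER BOUNDS
(Dyson/Lieb–Yngvason,
LHY: FournaisSolovej2020/2022, free energy: HaberbergerEtAl2023, FournaisEtAl2024), and the way
condensation is extracted
from them today is exactly a pinning term: FournaisEtAl2024/Junge2026 bound −T log Tr exp(−β(H_N − η
n₊/L²)) from below on
boxes L = a(ρa³)^{-1/2-η} (Junge2026 Thm 4, eq. (23)) and read off Tr(n₊Γ₀) ≤ C L² N ρa(ρa³)^{1/2+η}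
(eq. (25)); the
loss L² is why condensation currently stops at R ~ a(ρa³)^{-3/4-η} (Cor. 6). This route states the
thermodynamic-limit
target in that currency: a RELATIVE lower bound between the pinned and unpinned N-body ground-state
energies at precision
κN√(ρa³)/L² — impossible by absolute energy asymptotics (o(N) errors ≫ N/L²), so any proof must
exploit the cancellation
between the two identical Hamiltonians (interpolation in κ, Hellmann–Feynman: d/dκ E₀(κ) =
⟨n₀(u)⟩_κ/L²; concavity).
Imported viewpoint: convex analysis of the ground-state energy as a function of a source coupled to
the order parameter —
the canonical, number-conserving cousin of the Bogoliubov/Griffiths symmetry-breaking argument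
(LiebSeiringerYngvason2005 =
LSSY App. D: BEC ⇔ response of the energy to a condensate-coupled source), with the rank-one
projector |u⟩⟨u| replacing
√V(λa₀ + h.c.) so that everything is first-quantised and typable TODAY over Literature.BoseGas.
WHY ∃u AND κ/L². Dirichlet walls: the condensate wave function is the GP-type ground mode of the
box, not the constant
(free gas: −Δ_D + (κ/L²)P_{u₁} ≥ λ₁ + κ/L² iff κ ≤ 3π², true with u = sine product, C = 0; with u =
constant it FAILS).
Pinning strength must be O(L⁻²): for κ/L² replaced by a fixed μ the pinned ground state re-condenses
into the next mode at
cost ~N/L² ≪ μN (filed as the negative support item PhaseTwistObstruction, refutable with v = 0 and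
two orthogonal bumps).
RANKED CRUXES.
 2. PinnedLowerBound [crux, formal] — the thesis; heuristically true with κ < box gap constant, C =
Bogoliubov constant.
 3. PeriodicPinnedLowerBound [crux, formal] — same on the torus with u = constantMode (no ∃u); the
version the
    Neumann/periodic localisation technology (FournaisEtAl2024 Thm 1.3, Junge2026 Thm 3) addresses
first; feeds
    route BECPeriodicReduction (PeriodicPinnedLowerBound ⇒ PeriodicBEC given finite E₀^per, same
algebra as Assembly).
 9. GroundStateEnergyFinite [support] — E₀(N,(N/ρ)^{1/3}) < ⊤ for ρ < ρ₀(v), N large (place N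
symmetric C¹ bumps at
    mutual distance > R₀; needs ρ^{-1/3} > R₀). Hypothesis of the Assembly (ENNReal subtraction).
 9. ScatteringLengthFinite [support] — finite range ⇒ a ≠ ⊤ (LSSY2005 App. C: a ≤ R₀; trial φ = 1
off B_{R₀+ε}, 0 on B_{R₀}).
 9. PhaseTwistObstruction [support, NEGATIVE: signature is ¬(uniform-μ pinning)] — certifies the
κ/L² scaling.
 1. Assembly [formal]: GroundStateEnergyFinite → PinnedLowerBound → BoseEinsteinCondensation (choose
δ = κN/(4L²) as
    ENNReal, ρ₀' = min(ρ₀, (16C²a³)⁻¹) when C·a > 0; occupation_le_maxOccupation,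
le_condensateNumber; ~60 lines).
KILL CRITERIA. ¬PinnedLowerBound for some admissible v at all small ρ with EVERY κ > 0 (e.g. an
anomalously soft
non-phonon branch making re-condensation cost o(N/L²)) closes the route; ¬PeriodicPinnedLowerBound
likewise. A proof
that C must depend on ρ (fraction 1 − o(1) but not 1 − O(√(ρa³))) does NOT kill it: re-file with
(ρa³)^γ.
DEGENERATE CASES CHECKED. v ≡ 0: a = 0, statement reduces to the one-body gap, true (κ ≤ 3π²
Dirichlet, 4π² periodic).
a = ⊤ cannot occur (support item) and .toReal keeps the term total. E₀ = ⊤ makes rank 2 trivially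
true — hence the
finiteness hypothesis sits in the Assembly, not in the crux.
NOT DECOMPOSED. The κ-interpolation/second-order machinery behind rank 2; localisation into Neumann
cells; T > 0.
SOURCES. LiebSeiringerSolovejYngvason2005 §1.2, Ch. 2, App. C, App. D; LiebSeiringerYngvason2005;
FournaisSolovej2020;
FournaisSolovej2022; HaberbergerEtAl2023 (arXiv:2304.02405); FournaisEtAl2024 (arXiv:2408.14222) Thm
1.1/1.3;
Junge2026 (arXiv:2603.20776) Thm 4, (25), Cor. 6; ChongLiangNam2026.

Novelty: NOVELTY (retriage 2026-08-14; searches run BEFORE writing: lit frontier AtomisticToContinuum --since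
2020 (newest BEC descendants
Junge2026 = arXiv:2603.20776, ChongLiangNam2026 = arXiv:2510.20493); lit search "BEC beyond the
Gross-Pitaevskii regime" / "short proof
of BEC in the GP regime and beyond" (held: arXiv:2002.03406, arXiv:2401.00784, arXiv:2011.00309,
arXiv:2011.09450, arXiv:1812.03086);
lit read arXiv:2603.20776 pp5-6, arXiv:2408.14222 pp2-3, arXiv:2401.00784 pp2-3, arXiv:2510.20493
grep; lit vsearch/hybrid for
"Hamiltonian minus multiple of n_+ over L^2" and "convexity in a one-body source, Hellmann-Feynman"
(no paper hit beyond the above);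
lit bridges (nothing specific)).
NEAREST PRIOR ART.
(1) The n₊/L²-penalised lower bound IS in print, same sign as the crux (H_N − η n₊/L² bounded
below): FournaisEtAl2024
(arXiv:2408.14222) Thm 1.3 and Junge2026 (arXiv:2603.20776) Thm 4 eq. (23): −T log Tr exp(−β(H_N − η
n₊/L²)) ≥ 4πρaN(1 +
128/(15√π)√(ρa³) − C(ρa³)^{1/2+η}) + free-Bogoliubov T-term on NEUMANN boxes L = a(ρa³)^{−1/2−η}, v
≥ 0 radially decreasing,
compact support; read off (25): Tr(n₊Γ₀) ≤ C L² N ρa (ρa³)^{1/2+η}; propagated by Neumann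
localisation to R ≥ a(ρa³)^{−1/2−η}
(Cor. 6, Remark 7: scaling exponent κ_scal strictly below the thermodynamic 2/3). ChongLiangNam2026
(arXiv:2510.20493) §4:
sub-Hamiltonians controlled through −Δ_Λ − ℓ^{2+α}Q_Λ, again a kinetic-gap-size n₊ penalty, BEC for
κ_scal up to ~2/5.
(2) Operator coercivity "excess energy ≥ gap × n₊ − O(a  [refs: 2603.20776, 2510.20493, 2002.03406, 2401.00784, 2011.00309, 2011.09450, 1812.03086, 2408.14222, Junge2026, ChongLiangNam2026, FournaisEtAl2024, BoccatoEtAl2019, AdhikariBrenneckeSchlein2020, BrenneckeEtAl2024, Fournais2020, LSSY2005, LiebSeiringerYngvason2005, LiebSeiringerSolovejYngvason2005]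

Barriers (technique_class: n+-penalty kinetic-gap convexity-in-source relative-bound): BARRIERS (catalogue lean/Literature/Barriers/AtomisticToContinuum, BEC entries read 2026-08-14).
technique_class: n+-penalty kinetic-gap convexity-in-source relative-bound
- Literature.Barriers.AtomisticToContinuum.KineticGapLengthScales [kinetic-gap …]: APPLIES SQUARELY.
The cruxes are gap-scale
  coercivity statements (penalty κ/L²) at L = (N/ρ)^{1/3}; every printed argument of this class
bounds depletion by L² × (excess
  energy per particle), known only to LHY precision ρa(ρa³)^{1/2+η}, hence stops at L ≲
a(ρa³)^{−1/2−η} … R ~ a(ρa³)^{−3/4−η}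
  (LSSY2005 Thm 5.1 = Literature.Barriers.AtomisticToContinuum.BoseGas.LSSY2005_thm51_periodic;
Fournais2020 Thm 1.2; Junge2026 Cor. 6). The route does NOT evade it
  with a mechanism in hand. The bet: PinnedLowerBound compares two infima of Hamiltonians that
differ by a one-body rank-one term of
  total size ≤ κN/L², so E₀(0) − E₀(κ) = ∫₀^κ ⟨n₊(u)⟩_{κ'} dκ'/L² (Hellmann–Feynman, concave) might
be bounded through the
  anti-pinned ground states' depletion directly (monotone in κ), never through absolute energies; no
such argument exists in print,
  and if every route to ⟨n₊⟩_κ ≤ CN√(ρa³) itself needs LHY-precision energies on the full box, the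
barrier bites and rank 2/3 stall
  exactly where FournaisEtAl2024/Junge2026 stop. Kill/relax signal: a proof that C must grow like
L²ρa(ρa³)^{η} is the barrier
  reasserting itself (route then only re-derives Junge2026 Cor. 6 in Dirichlet/TrialState clothing).
- Literature.Barriers.AtomisticToC

History (route lifecycle, newest last):
- 2026-08-15T13:39:49Z · CLOSED retired — not-a-thesis: assembly does not conclude the sub-problem Statement (operator:999:1257524)

sub-problem: BoseEinsteinCondensation · status: closed(retired) · opened planner-plan-AtomisticToContinuum-BoseEinsteinCondensation-0 2026-08-13T19:15:43Z · rev 1 · ledger route-AtomisticToContinuum-BECPinning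
GENERATED by the gate from the ledger (D-0016/17). Provers cite these decls: `theorem foo : Summit.AtomisticToContinuum.BoseEinsteinCondensation.Theses.BECPinning.<Decl> := …` in Summits/AtomisticToContinuum/BoseEinsteinCondensation/Theorems/<Name>.lean.
-/

namespace Summit.AtomisticToContinuum.BoseEinsteinCondensation.Theses.BECPinning

open scoped BigOperators Topology Manifold Classical MeasureTheory ProbabilityTheory Matrix InnerProductSpace ComplexConjugate ContinuousMap
open Filter Set Function TopologicalSpace MeasureTheory

attribute [summit_statement] _root_.BoseEinsteinCondensation

/-- item stmt-AtomisticToContinuum-0848 · crux · rank 2 · closed · moot by None · by planner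
why it might fail: Implies thermodynamic-limit BEC at the sharp Bogoliubov rate O(√(ρa³)) uniformly over ALL states (stronger than the conjunct); every printed n₊/L²-penalty bound loses L²ρa(ρa³)^{1/2+η}, void at L=(N/ρ)^{1/3}; a collective branch re-condensing ⊥u at cost o(N/L²) would refute it for every κ>0.
sources: Junge2026 (arXiv:2603.20776) Thm 4 eq. (23), eq. (25), Cor. 6, Remark 7 — penalised bound only on L = a(ρa³)^{-1/2-η}, loss L², FournaisEtAl2024 (arXiv:2408.14222) Thm 1.3 — free energy with n₊ penalty on boxes ℓ ~ (ρa³)^{-η}(ρa)^{-1/2}, LiebSeiringerSolovejYngvason2005 Ch. 5 §5.1 (5.15)-(5.17), Thm 5.1 — depletion ≤ L² × excess energy; TL open, Literature.Barriers.AtomisticToContinuum.KineticGapLengthScales (Literature/Barriers/AtomisticToContinuum/KineticGapLengthScales.lean), ChongLiangNam2026 (arXiv:2510.20493) §1 p2 — TL BEC open 'due to the absence of a spectral gap in the large-volume limit', BoccatoEtAl2019 (arXiv:1812.03086) Thm 1.1 (1.9)-(1.10), Prop. 6.1 — the GP-regime (κ_scal = 0) instance of the same coercivity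
[crux] PinnedLowerBound (X_H): ∀ repulsive finite-range v ∃ C, κ>0, ρ₀>0 ∀ρ∈(0,ρ₀) ∀ᶠN ∃ normalised
measurable one-body mode u ∀ Dirichlet trial states Ψ (L=(N/ρ)^{1/3}, a=(scatteringLength
v).toReal): E₀(N,L) + (κ/L²)N(1 − C√(ρa³)) ≤ ⟨Ψ,H_NΨ⟩ + (κ/L²)⟨u,γ_Ψu⟩ — the pinned Hamiltonian H_N
+ (κ/L²)Σ_i|u⟩⟨u|_i has ground energy ≥ E₀ + full pinning reward up to Bogoliubov depletion.
Relative precision κN√(ρa³)/L² between two N-body infima; Hellmann–Feynman/concavity in κ. Pinning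
n₊/L² is the device of FournaisEtAl2024/Junge2026 (Thm 4, eq. (23),(25)) on boxes a(ρa³)^{-1/2-η};
here L=(N/ρ)^{1/3}→∞. v≡0: true with u = Dirichlet ground mode, κ ≤ 3π². Sources:
LiebSeiringerYngvason2005; FournaisEtAl2024; Junge2026; FournaisSolovej2020. -/
@[route_item "route-AtomisticToContinuum-BECPinning"]
def PinnedLowerBound : Prop :=
  ∀ v : ℝ → ENNReal, Literature.MathematicalPhysics.QuantumManyBody.BoseGas.IsRepulsiveFiniteRange v → ∃ C κ ρ₀ : ℝ, 0 < κ ∧ 0 < ρ₀ ∧ ∀ ρ : ℝ, 0 < ρ → ρ < ρ₀ → ∀ᶠ N : ℕ in Filter.atTop, ∃ u : EuclideanSpace ℝ (Fin 3) → ℂ, MeasureTheory.AEStronglyMeasurable u MeasureTheory.volume ∧ (∫⁻ x, (‖u x‖₊ : ENNReal) ^ 2) = 1 ∧ ∀ Ψ : Literature.MathematicalPhysics.QuantumManyBody.BoseGas.TrialState N (Literature.MathematicalPhysics.QuantumManyBody.BoseGas.sideLength ρ N), Literature.MathematicalPhysics.QuantumManyBody.BoseGas.groundStateEnergy v N (Literature.MathematicalPhysics.QuantumManyBody.BoseGas.sideLength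 ρ N) + ENNReal.ofReal (κ / Literature.MathematicalPhysics.QuantumManyBody.BoseGas.sideLength ρ N ^ 2 * N * (1 - C * Real.sqrt (ρ * (Literature.MathematicalPhysics.QuantumManyBody.BoseGas.scatteringLength v).toReal ^ 3))) ≤ Literature.MathematicalPhysics.QuantumManyBody.BoseGas.energy v Ψ + ENNReal.ofReal (κ / Literature.MathematicalPhysics.QuantumManyBody.BoseGas.sideLength ρ N ^ 2) * Literature.MathematicalPhysics.QuantumManyBody.BoseGas.occupation N u Ψ.ψ

/-- item stmt-AtomisticToContinuum-0849 · crux · rank 3 · closed · moot by None · by planner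
why it might fail: Equivalent to periodic TL BEC with O(√(ρa³)) depletion for all states — open (no spectral gap in the large-volume limit); print stops at L=a(ρa³)^{-1/2-η} / κ_scal≲2/5; the boost e^{2πiΣx_i/L}Ψ₀ costs exactly 4π²N/L², so κ(1−C√(ρa³))≤4π² is forced; any cheaper ⊥ re-condensation refutes every κ.
sources: ChongLiangNam2026 (arXiv:2510.20493) §1 p2, §4 (−Δ_Λ − ℓ^{2+α}Q_Λ penalty), BEC for κ_scal up to ~2/5 only, Junge2026 (arXiv:2603.20776) Thm 4, p6 'similarly done in [5] for the periodic setting', Remark 7, Fournais2020 (arXiv:2011.00309) Thm 1.2 = Literature.MathematicalPhysics.QuantumManyBody.BoseGas.Fournais2020_condensation (periodic, L = C(ρa³)^{-δ}(ρa)^{-1/2}); §1 after (1.12): 'does not work in the thermodynamic limit', BoccatoEtAl2019 (arXiv:1812.03086) Thm 1.1 (1.9) — unit-torus GP analogue with φ₀ = const, BrenneckeEtAl2024 (arXiv:2401.00784) Thm 1 — torus, κ_scal < 1/20; p2 'Proving BEC in the thermodynamic limit is a difficult open problem', Literature.Barriers.AtomisticToContinuum.KineticGapLengthScales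
[crux] PeriodicPinnedLowerBound: the same relative pinned lower bound on the torus of side
L=(N/ρ)^{1/3} with the constant mode (no ∃u): E₀^per(N,L) + (κ/L²)N(1 − C√(ρa³)) ≤ periodicEnergy v
Ψ + (κ/L²)·condensateOccupation N L Ψ for all periodic trial states Ψ, N large, ρ<ρ₀. The form
addressed first by Neumann/periodic localisation technology (FournaisEtAl2024 Thm 1.3, Junge2026 Thm
3, ChongLiangNam2026 Thm 1); implies route BECPeriodicReduction's PeriodicBEC given E₀^per < ⊤. v≡0:
true with κ ≤ 4π². -/
@[route_item "route-AtomisticToContinuum-BECPinning"]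
def PeriodicPinnedLowerBound : Prop :=
  ∀ v : ℝ → ENNReal, Literature.MathematicalPhysics.QuantumManyBody.BoseGas.IsRepulsiveFiniteRange v → ∃ C κ ρ₀ : ℝ, 0 < κ ∧ 0 < ρ₀ ∧ ∀ ρ : ℝ, 0 < ρ → ρ < ρ₀ → ∀ᶠ N : ℕ in Filter.atTop, ∀ Ψ : Literature.MathematicalPhysics.QuantumManyBody.BoseGas.PeriodicTrialState N (Literature.MathematicalPhysics.QuantumManyBody.BoseGas.sideLength ρ N), Literature.MathematicalPhysics.QuantumManyBody.BoseGas.periodicGroundStateEnergy v N (Literature.MathematicalPhysics.QuantumManyBody.BoseGas.sideLength ρ N) + ENNReal.ofReal (κ / Literature.MathematicalPhysics.QuantumManyBody.BoseGas.sideLength ρ N ^ 2 * N * (1 - C * Real.sqrt (ρ * (Literature.MathematicalPhysics.QuantumManyBody.BoseGas.scatteringLength v).toReal ^ 3))) ≤ Literature.MathematicalPhysics.QuantumManyBody.BoseGas.periodicEnergy v Ψ + ENNReal.ofReal (κ / Literature.MathematicalPhysics.QuantumManyBody.BoseGas.sideLength ρ N ^ 2) * Literature.MathematicalPhysics.QuantumManyBody.BoseGas.condensateOccupation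 N (Literature.MathematicalPhysics.QuantumManyBody.BoseGas.sideLength ρ N) Ψ.ψ

/-- item stmt-AtomisticToContinuum-0850 · support · rank 9 · closed · moot by None · by planner
[support] GroundStateEnergyFinite: for repulsive finite-range v (range R₀) there is ρ₀>0 (ρ₀ < R₀⁻³
works) such that for ρ<ρ₀ and all large N the Dirichlet ground-state energy groundStateEnergy v N
((N/ρ)^{1/3}) is finite: exhibit one symmetric C¹ trial state made of N disjoint bumps at mutual
distance > R₀ (interaction_eq_zero_of_lt_dist), finite kinetic energy. Hypothesis of the Assembly
(needed to subtract in ℝ≥0∞). [folklore; LiebSeiringerSolovejYngvason2005 (2.3)] -/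
@[route_item "route-AtomisticToContinuum-BECPinning"]
def GroundStateEnergyFinite : Prop :=
  ∀ v : ℝ → ENNReal, Literature.MathematicalPhysics.QuantumManyBody.BoseGas.IsRepulsiveFiniteRange v → ∃ ρ₀ : ℝ, 0 < ρ₀ ∧ ∀ ρ : ℝ, 0 < ρ → ρ < ρ₀ → ∀ᶠ N : ℕ in Filter.atTop, Literature.MathematicalPhysics.QuantumManyBody.BoseGas.groundStateEnergy v N (Literature.MathematicalPhysics.QuantumManyBody.BoseGas.sideLength ρ N) ≠ ⊤

/-- item stmt-AtomisticToContinuum-0851 · support · rank 9 · closed · moot by None · by planner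
[support] ScatteringLengthFinite: finite range R₀ ⇒ scatteringLength v ≠ ⊤ (indeed a ≤ R₀+ε: trial φ
∈ C¹, φ = 0 on B_{R₀}, φ = 1 off B_{R₀+ε}, so v·φ² = 0 incl. hard cores since ⊤·0 = 0).
[LiebSeiringerSolovejYngvason2005 App. C, Thm C.1 and Remark; scatteringLength_le] -/
@[route_item "route-AtomisticToContinuum-BECPinning"]
def ScatteringLengthFinite : Prop :=
  ∀ v : ℝ → ENNReal, Literature.MathematicalPhysics.QuantumManyBody.BoseGas.IsRepulsiveFiniteRange v → Literature.MathematicalPhysics.QuantumManyBody.BoseGas.scatteringLength v ≠ ⊤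

/-- item stmt-AtomisticToContinuum-0852 · support · rank 9 · closed · moot by None · by planner
[support][negative side, signature is a negation] PhaseTwistObstruction: the pinning strength cannot
be uniform in N — ¬(∀ v … ∃ C μ>0 ρ₀ … ∀ᶠN ∃u ∀Ψ: E₀ + μN(1 − C√(ρa³)) ≤ energy Ψ + μ·⟨u,γ_Ψu⟩).
Witness v ≡ 0 (a = 0, scatteringLength_zero): with two L²-orthogonal normalised C¹ product states
g₁^{⊗N}, g₂^{⊗N} of kinetic energy ≤ 100N/L², one has |⟨u,g_i⟩|² ≤ 1/2, and E₀ ≥ 0 gives μN ≤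
100N/L² + μN/2, false for large N. Certifies the κ/L² scaling of the cruxes. [folklore; Bogoliubov
phonon/phase-twist heuristics, LiebSeiringerSolovejYngvason2005 Ch. 5] -/
@[route_item "route-AtomisticToContinuum-BECPinning"]
def PhaseTwistObstruction : Prop :=
  ¬ (∀ v : ℝ → ENNReal, Literature.MathematicalPhysics.QuantumManyBody.BoseGas.IsRepulsiveFiniteRange v → ∃ C μ ρ₀ : ℝ, 0 < μ ∧ 0 < ρ₀ ∧ ∀ ρ : ℝ, 0 < ρ → ρ < ρ₀ → ∀ᶠ N : ℕ in Filter.atTop, ∃ u : EuclideanSpace ℝ (Fin 3) → ℂ, MeasureTheory.AEStronglyMeasurable u MeasureTheory.volume ∧ (∫⁻ x, (‖u x‖₊ : ENNReal) ^ 2) = 1 ∧ ∀ Ψ : Literature.MathematicalPhysics.QuantumManyBody.BoseGas.TrialState N (Literature.MathematicalPhysics.QuantumManyBody.BoseGas.sideLength ρ N), Literature.MathematicalPhysics.QuantumManyBody.BoseGas.groundStateEnergy v N (Literature.MathematicalPhysics.QuantumManyBody.BoseGas.sideLength ρ N) + ENNReal.ofReal (μ * N * (1 - C * Real.sqrt (ρ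 * (Literature.MathematicalPhysics.QuantumManyBody.BoseGas.scatteringLength v).toReal ^ 3))) ≤ Literature.MathematicalPhysics.QuantumManyBody.BoseGas.energy v Ψ + ENNReal.ofReal μ * Literature.MathematicalPhysics.QuantumManyBody.BoseGas.occupation N u Ψ.ψ)

/-- item stmt-AtomisticToContinuum-0853 · assembly · rank 1 · closed · moot by None · by planner
[assembly] GroundStateEnergyFinite → PinnedLowerBound → BoseEinsteinCondensation (hypotheses
inlined): for v, take C κ ρ₀; ρ₀' := min(ρ₀, ρ₀^{fin}, (16C²a³)⁻¹ if C·a>0); for large N (L>0, E₀<⊤)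
set δ := ofReal(κN/(4L²)) > 0; a δ-near-minimiser Ψ gives (κ/L²)·occ(u,Ψ) ≥ κN(1−C√(ρa³))/L² − δ ≥
κN/(4L²)... hence occ(u,Ψ) ≥ N/2·(1/2); occupation_le_maxOccupation (u measurable, normalised) and
le_condensateNumber give HasGroundStateBEC v ρ with c = 1/4. -/
@[route_item "route-AtomisticToContinuum-BECPinning"]
def Assembly : Prop :=
  (∀ v : ℝ → ENNReal, Literature.MathematicalPhysics.QuantumManyBody.BoseGas.IsRepulsiveFiniteRange v → ∃ ρ₀ : ℝ, 0 < ρ₀ ∧ ∀ ρ : ℝ, 0 < ρ → ρ < ρ₀ → ∀ᶠ N : ℕ in Filter.atTop, Literature.MathematicalPhysics.QuantumManyBody.BoseGas.groundStateEnergy v N (Literature.MathematicalPhysics.QuantumManyBody.BoseGas.sideLength ρ N) ≠ ⊤) → (∀ v : ℝ → ENNReal, Literature.MathematicalPhysics.QuantumManyBody.BoseGas.IsRepulsiveFiniteRange v → ∃ C κ ρ₀ : ℝ, 0 < κ ∧ 0 < ρ₀ ∧ ∀ ρ : ℝ, 0 < ρ → ρ < ρ₀ → ∀ᶠ N : ℕ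 in Filter.atTop, ∃ u : EuclideanSpace ℝ (Fin 3) → ℂ, MeasureTheory.AEStronglyMeasurable u MeasureTheory.volume ∧ (∫⁻ x, (‖u x‖₊ : ENNReal) ^ 2) = 1 ∧ ∀ Ψ : Literature.MathematicalPhysics.QuantumManyBody.BoseGas.TrialState N (Literature.MathematicalPhysics.QuantumManyBody.BoseGas.sideLength ρ N), Literature.MathematicalPhysics.QuantumManyBody.BoseGas.groundStateEnergy v N (Literature.MathematicalPhysics.QuantumManyBody.BoseGas.sideLength ρ N) + ENNReal.ofReal (κ / Literature.MathematicalPhysics.QuantumManyBody.BoseGas.sideLength ρ N ^ 2 * N * (1 - C * Real.sqrt (ρ * (Literature.MathematicalPhysics.QuantumManyBody.BoseGas.scatteringLength v).toReal ^ 3))) ≤ Literature.MathematicalPhysics.QuantumManyBody.BoseGas.energy v Ψ + ENNReal.ofReal (κ / Literature.MathematicalPhysics.QuantumManyBody.BoseGas.sideLength ρ N ^ 2) * Literature.MathematicalPhysics.QuantumManyBody.BoseGas.occupation N u Ψ.ψ) → Literature.MathematicalPhysics.QuantumManyBody.BoseGas.BoseEinsteinCondensation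

end Summit.AtomisticToContinuum.BoseEinsteinCondensation.Theses.BECPinning
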